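import Mathlib

/-!
# Clause 13-J, brick B7-T: FENCING LEMMAS for the far transport branch — amplified transport integrated inward,
# damped transport integrated outward

Route `FilamentSkeletonRss`, child 28296 `Clause13NearStraight` (and its A1L twin); design of record
`filament-plan/DESIGN-NOTE-28296-tenure-g22.md` §3 (I2) ("on the outer region integrate INWARD from the ball edge (Y = 0 there), where
β̄ ≥ β₀ > 0 … ⇒ |Y_far| ≤ ‖F‖_∞/β₀") and lane memo `DESIGN-28296-transport-g13.md` §3 (H).  On the far branch the linearised map
reduces (after J-averaging) to a transport system `w(τ)·Y′ = B(τ)Y + F` along the slip flow, `w > 0` away from the waist.  This file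
proves the two sup-norm consequences that bookkeeping uses, as pure real analysis in an inner-product space:

* `norm_le_of_inner_deriv_le` (forward fence): if `⟪Y′, Y⟫ ≤ ρ·‖Y‖(M − κ‖Y‖)` with a weight `ρ > 0` and `‖Y a‖ ≤ M/κ`, then
  `‖Y‖ ≤ M/κ` on `[a, b]` (Mathlib's fencing theorem `image_le_of_deriv_right_lt_deriv_boundary` applied to `‖Y‖²` against the
  constant fences `(M/κ + ε)²`);
* `norm_le_of_le_inner_deriv` (backward fence): if `⟪Y′, Y⟫ ≥ ρ·‖Y‖(κ‖Y‖ − M)` and `‖Y b‖ ≤ M/κ`, then `‖Y‖ ≤ M/κ` on `[a, b]`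
  (time reversal);
* `transport_norm_le_of_amplified` : `w•Y′ = B Y + F`, `w > 0`, `⟪B y, y⟫ ≥ β₀‖y‖²`, `‖F‖ ≤ M`, `‖Y b‖ ≤ M/β₀` ⇒ `‖Y‖ ≤ M/β₀` on
  `[a, b]` — the OUTER-REGION bound of the note (amplification outward = decay inward from the edge where `Y` vanishes);
* `transport_norm_le_of_damped` : `⟪B y, y⟫ ≤ −β₀‖y‖²`, `‖Y a‖ ≤ M/β₀` ⇒ `‖Y‖ ≤ M/β₀` on `[a, b]` — the INNER-REGION bound under a
  damping margin (e.g. the clause-12 margin `β̄ ≤ −δ/2` next to the waist in the rigid-core typing).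

Typing-agnostic (A1G/A1L), natively `L∞`.  Lane ns-filament-19175-p1 g13; `--supports stmt-NavierStokesRegularity-28296 --as helper`.
HONEST FRAMING: ODE lemmas for the bookkeeping of a HYPOTHETICAL filament skeleton on the NEGATIVE side of a MODEL route; nothing here
bears on Navier–Stokes regularity or blow-up.
-/

noncomputable section

open scoped InnerProductSpace
open Set

namespace Summit.NavierStokesRegularity.NavierStokesRegularity.Theorems.Clause13Transport
set_option linter.dupNamespace false

variable {E : Type*} [NormedAddCommGroup E] [InnerProductSpace ℝ E]

/-- **Forward fence.**  If `Y` is differentiable on `[a, b]` with `⟪Y′ τ, Y τ⟫ ≤ ρ τ · ‖Y τ‖ · (M − κ‖Y τ‖)` for a positive weight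
`ρ` (`κ > 0`, `M ≥ 0`) and `‖Y a‖ ≤ M/κ`, then `‖Y τ‖ ≤ M/κ` on `[a, b]`: the radial velocity points inward on every sphere of radius
`> M/κ`. [folklore] -/
theorem norm_le_of_inner_deriv_le {Y Y' : ℝ → E} {ρ : ℝ → ℝ} {a b M κ : ℝ} (hκ : 0 < κ) (hM : 0 ≤ M)
    (hderiv : ∀ τ ∈ Icc a b, HasDerivAt Y (Y' τ) τ) (hρ : ∀ τ ∈ Ico a b, 0 < ρ τ)
    (hrad : ∀ τ ∈ Ico a b, ⟪Y' τ, Y τ⟫_ℝ ≤ ρ τ * (‖Y τ‖ * (M - κ * ‖Y τ‖)))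
    (ha : ‖Y a‖ ≤ M / κ) : ∀ τ ∈ Icc a b, ‖Y τ‖ ≤ M / κ := by
  intro τ hτ
  have hMκ : 0 ≤ M / κ := div_nonneg hM hκ.le
  -- `‖Y‖² ≤ (M/κ + ε)²` for every `ε > 0`, by fencing
  have key : ∀ ε : ℝ, 0 < ε → ‖Y τ‖ ^ 2 ≤ (M / κ + ε) ^ 2 := by
    intro ε hε
    have hcont : ContinuousOn (fun s => ‖Y s‖ ^ 2) (Icc a b) := by
      have hc : ContinuousOn Y (Icc a b) := fun s hs => (hderiv s hs).continuousAt.continuousWithinAt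
      exact (hc.norm).pow 2
    have hf' : ∀ s ∈ Ico a b, HasDerivWithinAt (fun s => ‖Y s‖ ^ 2) (2 * ⟪Y s, Y' s⟫_ℝ) (Ici s) s := by
      intro s hs
      exact ((hderiv s (Ico_subset_Icc_self hs)).norm_sq).hasDerivWithinAt
    have ha' : ‖Y a‖ ^ 2 ≤ (M / κ + ε) ^ 2 := by
      have h1 : ‖Y a‖ ≤ M / κ + ε := by linarith
      exact pow_le_pow_left₀ (norm_nonneg _) h1 2
    have hB : ∀ s : ℝ, HasDerivAt (fun _ : ℝ => (M / κ + ε) ^ 2) 0 s := fun s => hasDerivAt_const s _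
    have bound : ∀ s ∈ Ico a b, ‖Y s‖ ^ 2 = (M / κ + ε) ^ 2 → 2 * ⟪Y s, Y' s⟫_ℝ < 0 := by
      intro s hs heq
      have hpos : 0 < M / κ + ε := by linarith
      have hnorm : ‖Y s‖ = M / κ + ε := by
        have := (sq_eq_sq₀ (norm_nonneg _) hpos.le).1 heq
        exact this
      have h1 := hrad s hs
      rw [real_inner_comm] at h1
      have hneg : ‖Y s‖ * (M - κ * ‖Y s‖) < 0 := by
        rw [hnorm]
        have : M - κ * (M / κ + ε) = -(κ * ε) := by field_simp; ring
        rw [this]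
        have hκε : 0 < κ * ε := mul_pos hκ hε
        nlinarith
      have := mul_neg_of_pos_of_neg (hρ s hs) hneg
      linarith
    exact image_le_of_deriv_right_lt_deriv_boundary hcont hf' ha' hB bound hτ
  -- let `ε → 0`
  have hle : ∀ ε : ℝ, 0 < ε → ‖Y τ‖ ≤ M / κ + ε := by
    intro ε hε
    have hpos : 0 ≤ M / κ + ε := by linarith
    exact (pow_le_pow_iff_left₀ (norm_nonneg _) hpos two_ne_zero).1 (key ε hε)
  exact le_of_forall_pos_le_add fun ε hε => hle ε hε

/-- **Backward fence.**  If `⟪Y′ τ, Y τ⟫ ≥ ρ τ · ‖Y τ‖ · (κ‖Y τ‖ − M)` on `(a, b]` for a positive weight `ρ` (`κ > 0`, `M ≥ 0`) and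
`‖Y b‖ ≤ M/κ`, then `‖Y τ‖ ≤ M/κ` on `[a, b]` (time reversal of the forward fence: outward amplification is inward decay). [folklore] -/
theorem norm_le_of_le_inner_deriv {Y Y' : ℝ → E} {ρ : ℝ → ℝ} {a b M κ : ℝ} (hκ : 0 < κ) (hM : 0 ≤ M)
    (hderiv : ∀ τ ∈ Icc a b, HasDerivAt Y (Y' τ) τ) (hρ : ∀ τ ∈ Ioc a b, 0 < ρ τ)
    (hrad : ∀ τ ∈ Ioc a b, ρ τ * (‖Y τ‖ * (κ * ‖Y τ‖ - M)) ≤ ⟪Y' τ, Y τ⟫_ℝ)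
    (hb : ‖Y b‖ ≤ M / κ) : ∀ τ ∈ Icc a b, ‖Y τ‖ ≤ M / κ := by
  intro τ hτ
  -- reversed path `Z s = Y (−s)` on `[−b, −a]`
  set Z : ℝ → E := fun s => Y (-s) with hZ
  set Z' : ℝ → E := fun s => -Y' (-s) with hZ'
  have hderivZ : ∀ s ∈ Icc (-b) (-a), HasDerivAt Z (Z' s) s := by
    intro s hs
    have hs' : -s ∈ Icc a b := ⟨by linarith [hs.2], by linarith [hs.1]⟩
    have h := (hderiv (-s) hs').scomp s (hasDerivAt_neg s)
    simpa [hZ, hZ', Function.comp_def] using h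
  have hρZ : ∀ s ∈ Ico (-b) (-a), 0 < ρ (-s) := fun s hs => hρ (-s) ⟨by linarith [hs.2], by linarith [hs.1]⟩
  have hradZ : ∀ s ∈ Ico (-b) (-a), ⟪Z' s, Z s⟫_ℝ ≤ ρ (-s) * (‖Z s‖ * (M - κ * ‖Z s‖)) := by
    intro s hs
    have hs' : -s ∈ Ioc a b := ⟨by linarith [hs.2], by linarith [hs.1]⟩
    have h := hrad (-s) hs'
    simp only [hZ, hZ', inner_neg_left]
    nlinarith [h]
  have hbZ : ‖Z (-b)‖ ≤ M / κ := by simpa [hZ] using hb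
  have := norm_le_of_inner_deriv_le (ρ := fun s => ρ (-s)) hκ hM hderivZ hρZ hradZ hbZ (-τ)
    ⟨by linarith [hτ.2], by linarith [hτ.1]⟩
  simpa [hZ] using this

/-- **Outer region: amplified transport integrated inward.**  Along `w(τ)•Y′ = B(τ)Y + F` on `[a, b]` with `w > 0`,
`⟪B τ y, y⟫ ≥ β₀‖y‖²` (`β₀ > 0`), `‖F τ‖ ≤ M` and `‖Y b‖ ≤ M/β₀` (e.g. `Y b = 0` at the ball edge): `‖Y τ‖ ≤ M/β₀` on `[a, b]`.
This is the bound `|Y_far| ≤ ‖F‖_∞/β₀` of the tenure note (I2), outer region. [folklore] -/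
theorem transport_norm_le_of_amplified {Y Y' F : ℝ → E} {B : ℝ → E →L[ℝ] E} {w : ℝ → ℝ} {a b M β₀ : ℝ}
    (hβ₀ : 0 < β₀) (hM : 0 ≤ M) (hderiv : ∀ τ ∈ Icc a b, HasDerivAt Y (Y' τ) τ)
    (hode : ∀ τ ∈ Icc a b, w τ • Y' τ = B τ (Y τ) + F τ) (hw : ∀ τ ∈ Icc a b, 0 < w τ)
    (hB : ∀ τ ∈ Icc a b, ∀ y : E, β₀ * ‖y‖ ^ 2 ≤ ⟪B τ y, y⟫_ℝ) (hF : ∀ τ ∈ Icc a b, ‖F τ‖ ≤ M)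
    (hb : ‖Y b‖ ≤ M / β₀) : ∀ τ ∈ Icc a b, ‖Y τ‖ ≤ M / β₀ := by
  refine norm_le_of_le_inner_deriv (ρ := fun τ => (w τ)⁻¹) hβ₀ hM hderiv
    (fun τ hτ => inv_pos.mpr (hw τ (Ioc_subset_Icc_self hτ))) (fun τ hτ => ?_) hb
  have hτ' := Ioc_subset_Icc_self hτ
  have hwτ := hw τ hτ'
  -- `⟪Y′, Y⟫ = (⟪B Y, Y⟫ + ⟪F, Y⟫)/w ≥ (β₀‖Y‖² − M‖Y‖)/w`
  have hY' : Y' τ = (w τ)⁻¹ • (B τ (Y τ) + F τ) := by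
    rw [← hode τ hτ', smul_smul, inv_mul_cancel₀ hwτ.ne', one_smul]
  rw [hY', real_inner_smul_left, inner_add_left]
  have h1 := hB τ hτ' (Y τ)
  have h2 : -(M * ‖Y τ‖) ≤ ⟪F τ, Y τ⟫_ℝ := by
    have := abs_real_inner_le_norm (F τ) (Y τ)
    have hF' := hF τ hτ'
    have : |⟪F τ, Y τ⟫_ℝ| ≤ M * ‖Y τ‖ := this.trans (mul_le_mul_of_nonneg_right hF' (norm_nonneg _))
    linarith [abs_le.1 this]
  have hinv : 0 < (w τ)⁻¹ := inv_pos.mpr hwτ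
  have : ‖Y τ‖ * (β₀ * ‖Y τ‖ - M) ≤ ⟪B τ (Y τ), Y τ⟫_ℝ + ⟪F τ, Y τ⟫_ℝ := by nlinarith
  exact mul_le_mul_of_nonneg_left this hinv.le

/-- **Inner region: damped transport integrated outward.**  Along `w(τ)•Y′ = B(τ)Y + F` on `[a, b]` with `w > 0`,
`⟪B τ y, y⟫ ≤ −β₀‖y‖²` (`β₀ > 0`), `‖F τ‖ ≤ M` and `‖Y a‖ ≤ M/β₀`: `‖Y τ‖ ≤ M/β₀` on `[a, b]`. [folklore] -/
theorem transport_norm_le_of_damped {Y Y' F : ℝ → E} {B : ℝ → E →L[ℝ] E} {w : ℝ → ℝ} {a b M β₀ : ℝ}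
    (hβ₀ : 0 < β₀) (hM : 0 ≤ M) (hderiv : ∀ τ ∈ Icc a b, HasDerivAt Y (Y' τ) τ)
    (hode : ∀ τ ∈ Icc a b, w τ • Y' τ = B τ (Y τ) + F τ) (hw : ∀ τ ∈ Icc a b, 0 < w τ)
    (hB : ∀ τ ∈ Icc a b, ∀ y : E, ⟪B τ y, y⟫_ℝ ≤ -(β₀ * ‖y‖ ^ 2)) (hF : ∀ τ ∈ Icc a b, ‖F τ‖ ≤ M)
    (ha : ‖Y a‖ ≤ M / β₀) : ∀ τ ∈ Icc a b, ‖Y τ‖ ≤ M / β₀ := by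
  refine norm_le_of_inner_deriv_le (ρ := fun τ => (w τ)⁻¹) hβ₀ hM hderiv
    (fun τ hτ => inv_pos.mpr (hw τ (Ico_subset_Icc_self hτ))) (fun τ hτ => ?_) ha
  have hτ' := Ico_subset_Icc_self hτ
  have hwτ := hw τ hτ'
  have hY' : Y' τ = (w τ)⁻¹ • (B τ (Y τ) + F τ) := by
    rw [← hode τ hτ', smul_smul, inv_mul_cancel₀ hwτ.ne', one_smul]
  rw [hY', real_inner_smul_left, inner_add_left]
  have h1 := hB τ hτ' (Y τ)
  have h2 : ⟪F τ, Y τ⟫_ℝ ≤ M * ‖Y τ‖ := by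
    have := abs_real_inner_le_norm (F τ) (Y τ)
    have : |⟪F τ, Y τ⟫_ℝ| ≤ M * ‖Y τ‖ := this.trans (mul_le_mul_of_nonneg_right (hF τ hτ') (norm_nonneg _))
    linarith [abs_le.1 this]
  have hinv : 0 < (w τ)⁻¹ := inv_pos.mpr hwτ
  have : ⟪B τ (Y τ), Y τ⟫_ℝ + ⟪F τ, Y τ⟫_ℝ ≤ ‖Y τ‖ * (M - β₀ * ‖Y τ‖) := by nlinarith
  exact mul_le_mul_of_nonneg_left this hinv.le

end Summit.NavierStokesRegularity.NavierStokesRegularity.Theorems.Clause13Transport
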